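import Mathlib.Combinatorics.SimpleGraph.Tutte
import Summits.PneNP.PneNP.Theorems.ConvexRankGatesLinAlgGateBlindLogWidthDoors
import Summits.PneNP.PneNP.Theorems.ConvexRankGatesLinAlgGateBlindLevelHost

/-!
# Route ConvexRankGates, crux `LinAlgGateBlind` (stmt-PneNP-10681): the Tutte door — perfect-matching gates on `≤ m^{7/8-o(1)}` vertices, unconditionally

Support theorems for the crux (vocabulary of `Theorems/ConvexRankGatesLinAlgGateBlindDefs.lean`). The perfect-matching
function of GENERAL graphs is the route's flagship "monotone-hard / algebraically easy" witness (`Capture`: one Tutte-matrix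
GRANK gate). This file closes the door on it as a WIDE GATE at the full union-bound range, with the bit count `d log₂ d` of
`PERM_d` (`sgAt_perm_logWidth`): `exists_tutteLabelling` (Tutte's theorem, Mathlib `exists_isTutteViolator`, as a labelling
whose completed graph has no perfect matching), `sgAt_tutte_of_cover_budget` (the Tutte cover of the inline class `TUTTE_d`:
pattern data `P₀, P_i ⊆ [d'] × [d']`, `d' ≤ d`, ACCEPT iff the graph on `[d']` spanned by `P₀ ∪ ⋃_{v_i = 1} P_i` has a
perfect matching; `≤ (d+1)^d` all-off events), `sgAt_tutte_logWidth` (every `d` with `d log₂ d ≤ m^{7/8}/(log₂ m)^5`),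
`monotone_of_tutte`, `isTermGate_tutte_collapse`, `not_computes_clique_of_isOver_tutte_logWidth` (NO circuit with `≤ m^c`
gates over `{∧₂, ∨₂} ∪ TUTTE_d` computes `CLIQUE(m, ⌈m^{1/8}⌉)`; matching-NUMBER thresholds are the case of universal
vertices in `P₀`). Sources: Tutte 1947; Razborov 1985, Alon–Boppana 1987 §3; planting theorem, host and budgets are the
tree's. No new definitions. [folklore]
-/

-- `Summit.PneNP.PneNP.…` duplicates `PneNP` BY DESIGN (single-problem summit).
set_option linter.dupNamespace false

noncomputable section

namespace Summit.PneNP.PneNP.Theorems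

open Finset Filter Literature.Computability.Complexity Razborov SimpleGraph
open Summit.PneNP.PneNP.Cruxes.LinAlgGateBlind.DnfInvariantWideGatesSeeSmallCliques
open Summit.PneNP.PneNP.Cruxes.LinAlgGateBlind.DnfInvariantWideGatesSeeSmallCliques.DenseRegime

/-- **Tutte labelling.** A finite graph without a perfect matching has a labelling by `Option V` such that every edge joins
equal labels or touches a `none` label, and the COMPLETED graph (`a ~ b` iff `a ≠ b` and (equal labels or a `none` label))
still has no perfect matching (odd order: all `none`; even order: a Tutte violator `u` ↦ `none`, the rest by component of
`H - u` — a perfect matching of the completion matches a vertex of each odd component into `u`, injectively). [folklore] -/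
theorem exists_tutteLabelling {V : Type*} [Fintype V] [DecidableEq V] (H : SimpleGraph V)
    (hH : ∀ M : H.Subgraph, ¬ M.IsPerfectMatching) :
    ∃ lab : V → Option V, (∀ a b, H.Adj a b → (lab a = lab b ∨ lab a = none ∨ lab b = none)) ∧
      ∀ M : (SimpleGraph.fromRel fun a b : V => lab a = lab b ∨ lab a = none ∨ lab b = none).Subgraph,
        ¬ M.IsPerfectMatching := by
  classical
  rcases Nat.even_or_odd (Fintype.card V) with heven | hodd
  · -- a Tutte violator `u`
    obtain ⟨u, hu⟩ := exists_isTutteViolator hH (by rwa [Nat.card_eq_fintype_card])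
    set G₀ := ((⊤ : H.Subgraph).deleteVerts u).coe with hG₀
    have hmem : ∀ v, v ∉ u → v ∈ ((⊤ : H.Subgraph).deleteVerts u).verts := fun v hv => by
      simp [hv]
    -- embed the components of `H - u` into `V`
    have hcard : Nat.card G₀.ConnectedComponent ≤ Nat.card V :=
      (Nat.card_le_card_of_surjective _ fun c => c.exists_rep).trans
        (Nat.card_le_card_of_injective _ Subtype.val_injective)
    obtain ⟨f, hf⟩ : ∃ f : G₀.ConnectedComponent → V, Function.Injective f :=
      ⟨fun c => (Finite.equivFin V).symm (Fin.castLE hcard (Finite.equivFin _ c)),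
        (Finite.equivFin V).symm.injective.comp ((Fin.castLE_injective hcard).comp (Finite.equivFin _).injective)⟩
    set lab : V → Option V := fun v =>
      if hv : v ∈ u then none else some (f (G₀.connectedComponentMk ⟨v, hmem v hv⟩)) with hlab
    have hlab_u : ∀ v, v ∈ u → lab v = none := fun v hv => by simp [hlab, hv]
    have hlab_nu : ∀ v (hv : v ∉ u), lab v = some (f (G₀.connectedComponentMk ⟨v, hmem v hv⟩)) :=
      fun v hv => by simp [hlab, hv]
    have hlab_ne : ∀ v, v ∉ u → lab v ≠ none := fun v hv => by rw [hlab_nu v hv]; exact Option.some_ne_none _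
    have hlab_eq : ∀ v w (hv : v ∉ u) (hw : w ∉ u), lab v = lab w →
        G₀.connectedComponentMk ⟨v, hmem v hv⟩ = G₀.connectedComponentMk ⟨w, hmem w hw⟩ := by
      intro v w hv hw h
      rw [hlab_nu v hv, hlab_nu w hw, Option.some_inj] at h
      exact hf h
    refine ⟨lab, fun a b hab => ?_, fun M hM => ?_⟩
    · by_cases ha : a ∈ u
      · exact Or.inr (Or.inl (hlab_u a ha))
      by_cases hb : b ∈ u
      · exact Or.inr (Or.inr (hlab_u b hb))
      left
      rw [hlab_nu a ha, hlab_nu b hb]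
      congr 2
      apply ConnectedComponent.connectedComponentMk_eq_of_adj
      simp only [hG₀, Subgraph.coe_adj, Subgraph.deleteVerts_adj, Subgraph.verts_top, Set.mem_univ, true_and,
        Subgraph.top_adj]
      exact ⟨ha, hb, hab⟩
    · -- every odd component of `H - u` has a vertex matched (in `M`) into `u`
      have key : ∀ c : G₀.oddComponents, ∃ w ∈ u, ∃ v : ((⊤ : H.Subgraph).deleteVerts u).verts,
          M.Adj v w ∧ v ∈ c.val.supp := by
        intro c
        by_contra! h
        have hMmatch : (M.induce (Subtype.val '' c.val.supp)).IsMatching := by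
          intro v hv
          obtain ⟨⟨v', hv'⟩, hvc, rfl⟩ := hv
          obtain ⟨w, hw⟩ := hM.1 (hM.2 v')
          have hv'u : v' ∉ u := by
            simpa only [Subgraph.deleteVerts_verts, Subgraph.verts_top, Set.mem_sdiff, Set.mem_univ, true_and] using hv'
          have hwu : w ∉ u := fun hwu => h w hwu ⟨v', hv'⟩ hw.1 hvc
          have hadj := M.adj_sub hw.1
          rw [fromRel_adj] at hadj
          have hlvw : lab v' = lab w := by
            have h1 := hlab_ne v' hv'u
            have h2 := hlab_ne w hwu
            rcases hadj.2 with (h | h | h) | (h | h | h) <;> first | exact h | exact h.symm | contradiction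
          have hwc : (⟨w, hmem w hwu⟩ : ((⊤ : H.Subgraph).deleteVerts u).verts) ∈ c.val.supp := by
            rw [ConnectedComponent.mem_supp_iff] at hvc ⊢
            rw [← hvc]
            exact (hlab_eq v' w hv'u hwu hlvw).symm
          exact ⟨w, ⟨⟨⟨v', hv'⟩, hvc, rfl⟩, ⟨⟨w, hmem w hwu⟩, hwc, rfl⟩, hw.1⟩, fun y hy => hw.2 y hy.2.2⟩
        apply Nat.not_even_iff_odd.2 c.prop
        haveI : Fintype ↑(Subgraph.induce M (Subtype.val '' c.val.supp)).verts := Fintype.ofFinite _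
        haveI := Fintype.ofFinite c.val.supp
        simpa [Finset.card_image_of_injective] using hMmatch.even_card
      choose fw hfw gv hgv hgc using key
      have hinj : Function.Injective fw := fun c d hcd => by
        have h1 : gv c = gv d := Subtype.val_injective (hM.1.eq_of_adj_right (hgv c) (hcd ▸ hgv d))
        exact Subtype.val_injective (ConnectedComponent.eq_of_common_vertex (hgc c) (h1 ▸ hgc d))
      have hle : Nat.card G₀.oddComponents ≤ Nat.card u :=
        Nat.card_le_card_of_injective (fun c => (⟨fw c, hfw c⟩ : u)) fun c d h => hinj (by simpa using h)
      rw [IsTutteViolator, ← Nat.card_coe_set_eq, ← Nat.card_coe_set_eq] at hu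
      exact absurd hu (not_lt.2 hle)
  · refine ⟨fun _ => none, fun a b _ => Or.inr (Or.inl rfl), fun M hM => ?_⟩
    exact Nat.not_even_iff_odd.2 hodd hM.even_card

/-- A perfect matching of a graph is a perfect matching of every supergraph on the same vertices (`Subgraph.map` along
`Hom.ofLE`). [folklore] -/
theorem exists_isPerfectMatching_of_le {V : Type*} {G G' : SimpleGraph V} (h : G ≤ G')
    (hM : ∃ M : G.Subgraph, M.IsPerfectMatching) : ∃ M' : G'.Subgraph, M'.IsPerfectMatching := by
  obtain ⟨M, hM⟩ := hM
  refine ⟨M.map (Hom.ofLE h), hM.1.map_ofLE h, fun v => ?_⟩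
  rw [Subgraph.map_verts]
  exact ⟨v, hM.2 v, rfl⟩

/-- **SG for perfect-matching term gates under the two planting budgets (the Tutte cover).** Under `0 ≤ q ≤ 1`,
`1 - q^{C(l,2)} ≤ 1/2`, `0 < ε`, `2t ≤ l`, the POSITIVE budget `(ν·C(l,2))^t · C(m-t, k-t) ≤ ε·C(m,k)` and the FRAGILITY
budget `(d+1)^d · (1/2)^{ν+1} · #𝒱(l) < ε`: `SGAt m (TUTTE_d) l k q ε`. A perfect-matching term gate rejects `x` iff for some
labelling `lab : [d'] → Option [d']` whose completed graph has no perfect matching and which no cell of `P₀` crosses, every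
atom owning a CROSSING cell (distinct non-`none` labels) is absent (`⇒` `exists_tutteLabelling`; `⇐` the live graph lies
below the completed graph); these `≤ (d+1)^d` all-off events feed `sg_of_maxtermCover` (`η = ε/#𝒱(l)`). [folklore] -/
theorem sgAt_tutte_of_cover_budget : ∀ (m l k d ν t : ℕ) (q ε : ℝ), 0 ≤ q → q ≤ 1 →
    1 - q ^ (l.choose 2) ≤ 1 / 2 → 0 < ε → 2 * t ≤ l →
    (((ν * l.choose 2) ^ t * (m - t).choose (k - t) : ℕ) : ℝ) ≤ ε * (m.choose k : ℝ) →
    ((d : ℝ) + 1) ^ d * (1 / 2) ^ (ν + 1) * #(smallSets (Fin m) l) < ε →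
    SGAt m (fun g => ∃ d' : ℕ, d' ≤ d ∧ ∃ (P₀ : Set (Fin d' × Fin d')) (P : Fin g.1 → Set (Fin d' × Fin d')),
      ∀ v : Fin g.1 → Bool, g.2 v = true ↔
        ∃ M : (SimpleGraph.fromRel fun a b : Fin d' =>
          (a, b) ∈ {x : Fin d' × Fin d' | x ∈ P₀ ∨ ∃ i, v i = true ∧ x ∈ P i}).Subgraph, M.IsPerfectMatching)
      l k q ε := by
  intro m l k d ν t q ε hq0 hq1 hql hε htl hpos hfrag O hO
  classical
  obtain ⟨g, ⟨d', hd', P₀, P, hg⟩, X, hX, hOX⟩ := hO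
  -- crossing cells of a labelling
  set cross : (Fin d' → Option (Fin d')) → Fin d' × Fin d' → Prop :=
    fun lab y => lab y.1 ≠ lab y.2 ∧ lab y.1 ≠ none ∧ lab y.2 ≠ none with hcross
  have hcross_iff : ∀ lab y, ¬ cross lab y ↔ (lab y.1 = lab y.2 ∨ lab y.1 = none ∨ lab y.2 = none) := by
    intro lab y
    simp only [hcross]
    tauto
  -- the completed graph of a labelling
  set K : (Fin d' → Option (Fin d')) → SimpleGraph (Fin d') :=
    fun lab => SimpleGraph.fromRel fun a b : Fin d' => lab a = lab b ∨ lab a = none ∨ lab b = none with hK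
  -- the live graph of an input vector
  set S : (Fin g.1 → Bool) → Set (Fin d' × Fin d') :=
    fun v => {x : Fin d' × Fin d' | x ∈ P₀ ∨ ∃ i, v i = true ∧ x ∈ P i} with hS
  set lv : (KEdge m → Bool) → Fin g.1 → Bool := fun x a => atomB (X a) x with hlv
  have hlv_iff : ∀ x a, lv x a = true ↔ CliquePresent (X a) x := fun x a => by simp [hlv, atomB]
  have hO_iff : ∀ x, O x = true ↔
      ∃ M : (SimpleGraph.fromRel fun a b : Fin d' => (a, b) ∈ S (lv x)).Subgraph, M.IsPerfectMatching := by
    intro x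
    rw [hOX x]
    exact hg (lv x)
  -- a live graph none of whose cells crosses `lab` lies below the completed graph of `lab`
  have hbelow : ∀ (lab : Fin d' → Option (Fin d')) (v : Fin g.1 → Bool), (∀ y ∈ S v, ¬ cross lab y) →
      (SimpleGraph.fromRel fun a b : Fin d' => (a, b) ∈ S v) ≤ K lab := by
    intro lab v hv a b hab
    rw [fromRel_adj] at hab
    simp only [hK, fromRel_adj]
    refine ⟨hab.1, ?_⟩
    rcases hab.2 with h | h
    · exact Or.inl ((hcross_iff lab (a, b)).1 (hv _ h))
    · exact Or.inr ((hcross_iff lab (b, a)).1 (hv _ h))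
  -- index the cover by the admissible labellings
  have hV : (0 : ℝ) < #(smallSets (Fin m) l) := Nat.cast_pos.2 (card_pos.2 ⟨∅, empty_mem_smallSets l⟩)
  set J := {lab : Fin d' → Option (Fin d') // (∀ y ∈ P₀, ¬ cross lab y) ∧
    ∀ M : (K lab).Subgraph, ¬ M.IsPerfectMatching} with hJ
  set N := Nat.card J with hNdef
  set e : J ≃ Fin N := Finite.equivFin J with he
  set 𝓛 : Fin N → Finset (Finset (Fin m)) := fun j =>
    (univ.filter fun a => ∃ y ∈ P a, cross (e.symm j).1 y).image X with h𝓛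
  have hNle : (N : ℝ) ≤ ((d : ℝ) + 1) ^ d := by
    have h1 : N ≤ Nat.card (Fin d' → Option (Fin d')) :=
      Nat.card_le_card_of_injective (Subtype.val : J → Fin d' → Option (Fin d')) Subtype.val_injective
    have h2 : Nat.card (Fin d' → Option (Fin d')) = (d' + 1) ^ d' := by
      rw [Nat.card_eq_fintype_card, Fintype.card_fun, Fintype.card_option, Fintype.card_fin]
    have h3 : (d' + 1) ^ d' ≤ (d + 1) ^ d :=
      (Nat.pow_le_pow_left (by omega) d').trans (Nat.pow_le_pow_right (by omega) hd')
    exact_mod_cast (h1.trans_eq h2).trans h3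
  have hN : (N : ℝ) * (1 / 2) ^ (ν + 1) < ε / #(smallSets (Fin m) l) := by
    rw [lt_div_iff₀ hV]
    calc (N : ℝ) * (1 / 2) ^ (ν + 1) * #(smallSets (Fin m) l)
        ≤ ((d : ℝ) + 1) ^ d * (1 / 2) ^ (ν + 1) * #(smallSets (Fin m) l) := by gcongr
      _ < ε := hfrag
  have h1 : ∀ j, 𝓛 j ⊆ smallSets (Fin m) l := by
    intro j Y hY
    obtain ⟨a, -, rfl⟩ := mem_image.1 hY
    exact hX a
  have h2 : ∀ x, O x = false → ∃ j, ∀ Y ∈ 𝓛 j, ¬ CliquePresent Y x := by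
    intro x hx
    have hno : ∀ M : (SimpleGraph.fromRel fun a b : Fin d' => (a, b) ∈ S (lv x)).Subgraph,
        ¬ M.IsPerfectMatching := by
      intro M hM
      have := (hO_iff x).2 ⟨M, hM⟩
      rw [hx] at this
      exact Bool.false_ne_true this
    obtain ⟨lab, hA, hB⟩ := exists_tutteLabelling _ hno
    -- no live cell crosses `lab`
    have hlive : ∀ y ∈ S (lv x), ¬ cross lab y := by
      intro y hy hc
      by_cases hyy : y.1 = y.2
      · exact hc.1 (by rw [hyy])
      have hadj : (SimpleGraph.fromRel fun a b : Fin d' => (a, b) ∈ S (lv x)).Adj y.1 y.2 := by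
        rw [fromRel_adj]
        exact ⟨hyy, Or.inl hy⟩
      exact (hcross_iff lab y).2 (hA _ _ hadj) hc
    refine ⟨e ⟨lab, fun y hy => hlive y (Or.inl hy), hB⟩, fun Y hY => ?_⟩
    obtain ⟨a, ha, rfl⟩ := mem_image.1 hY
    rw [mem_filter, Equiv.symm_apply_apply] at ha
    obtain ⟨y, hyP, hyc⟩ := ha.2
    intro hpres
    exact hlive y (Or.inr ⟨a, (hlv_iff x a).2 hpres, hyP⟩) hyc
  have h3 : ∀ j x, (∀ Y ∈ 𝓛 j, ¬ CliquePresent Y x) → O x = false := by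
    intro j x hall
    cases hx : O x
    · rfl
    · exfalso
      obtain ⟨M, hM⟩ := (hO_iff x).1 hx
      have hle : (SimpleGraph.fromRel fun a b : Fin d' => (a, b) ∈ S (lv x)) ≤ K (e.symm j).1 := by
        refine hbelow _ _ fun y hy => ?_
        rcases hy with hy | ⟨a, ha, hy⟩
        · exact (e.symm j).2.1 y hy
        · intro hc
          exact hall (X a) (mem_image_of_mem X (mem_filter.2 ⟨mem_univ a, y, hy, hc⟩)) ((hlv_iff x a).1 ha)
      obtain ⟨M', hM'⟩ := exists_isPerfectMatching_of_le hle ⟨M, hM⟩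
      exact (e.symm j).2.2 M' hM'
  obtain ⟨𝒜, h𝒜, hP, hNg⟩ := sg_of_maxtermCover m l k N ν t q (ε / #(smallSets (Fin m) l)) O 𝓛 h1 h2 h3
    hq0 hq1 hql (div_pos hε hV) hN htl
  refine ⟨𝒜, h𝒜, ?_, hNg.trans_eq (mul_div_cancel₀ ε hV.ne')⟩
  calc (#(lostPos m k O 𝒜) : ℝ) ≤ (((ν * l.choose 2) ^ t * (m - t).choose (k - t) : ℕ) : ℝ) := by
        exact_mod_cast hP
    _ ≤ ε * (m.choose k : ℝ) := hpos

/-- **`SGAt` for `TUTTE_d`, `d log₂ d ≤ m^{7/8}/(log₂ m)^5`, at the logarithmic width, at every level `c`, eventually in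
`m`** (the range of the PERM door `sgAt_perm_logWidth`): `sgAt_tutte_of_cover_budget` (`N ≤ (d+1)^d ≤ 2^{d(⌊log₂ d⌋+1)}`)
with the budgets of `logWidth_common` at `T = d(⌊log₂ d⌋+1) + Λ·L` and `cover_budget_two_pow`. [folklore] -/
theorem sgAt_tutte_logWidth : ∀ c : ℕ, ∀ᶠ m : ℕ in atTop, ∀ d : ℕ,
    (d : ℝ) * Real.logb 2 d ≤ (m : ℝ) ^ (7 / 8 : ℝ) / Real.logb 2 m ^ 5 →
      SGAt m (fun g => ∃ d' : ℕ, d' ≤ d ∧ ∃ (P₀ : Set (Fin d' × Fin d')) (P : Fin g.1 → Set (Fin d' × Fin d')),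
        ∀ v : Fin g.1 → Bool, g.2 v = true ↔
          ∃ M : (SimpleGraph.fromRel fun a b : Fin d' =>
            (a, b) ∈ {x : Fin d' × Fin d' | x ∈ P₀ ∨ ∃ i, v i = true ∧ x ∈ P i}).Subgraph, M.IsPerfectMatching)
        ((2 * c + 8) * (Nat.log 2 m + 1)) (kOf m) (qOf m) (epsOf c m) := by
  intro c
  filter_upwards [logWidth_common c] with m hm d hd
  have hT : ((((Nat.log 2 d + 1) * d + (Nat.log 2 m + 1) * ((2 * c + 8) * (Nat.log 2 m + 1)) : ℕ) : ℝ)) ≤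
      16 * ((c : ℝ) + 4) * Real.logb 2 m ^ 2 * ((m : ℝ) ^ (7 / 8 : ℝ) / Real.logb 2 m ^ 5) := by
    obtain ⟨-, -, -, -, -, -, -, -, -, -, hℓ1, h5, hΛL⟩ := hm 0 (by
      push_cast
      exact mul_nonneg (mul_nonneg (by positivity) (sq_nonneg _))
        (div_nonneg (Real.rpow_nonneg (Nat.cast_nonneg m) _) (pow_nonneg (logb_two_nonneg m) 5)))
    have hβ1 : 1 ≤ (m : ℝ) ^ (7 / 8 : ℝ) / Real.logb 2 m ^ 5 := by
      rw [le_div_iff₀ (by positivity), one_mul]; exact h5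
    have hc0 : (0 : ℝ) ≤ c := Nat.cast_nonneg c
    have h8 : (2 : ℝ) ≤ 8 * ((c : ℝ) + 4) * Real.logb 2 m ^ 2 := by nlinarith
    push_cast
    set β := (m : ℝ) ^ (7 / 8 : ℝ) / Real.logb 2 m ^ 5 with hβ
    set P := 8 * ((c : ℝ) + 4) * Real.logb 2 m ^ 2 with hP
    have hd0 : (0 : ℝ) ≤ d := Nat.cast_nonneg d
    have hlog : (Nat.log 2 d : ℝ) ≤ Real.logb 2 d := Real.natLog_le_logb d 2
    -- `d ≤ β`: either `d ≤ 1 ≤ β` or `log₂ d ≥ 1` and `d ≤ d log₂ d ≤ β`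
    have hdβ : (d : ℝ) ≤ β := by
      rcases le_or_gt d 1 with hd1 | hd1
      · exact le_trans (by exact_mod_cast hd1) hβ1
      · have hlog1 : (1 : ℝ) ≤ Real.logb 2 d := by
          rw [Real.le_logb_iff_rpow_le one_lt_two (by exact_mod_cast (by omega : 0 < d)), Real.rpow_one]
          exact_mod_cast hd1
        nlinarith
    have h1 : ((Nat.log 2 d : ℝ) + 1) * d ≤ P * β := by
      have : ((Nat.log 2 d : ℝ) + 1) * d ≤ β + β := by nlinarith
      nlinarith
    have h2 : ((Nat.log 2 m : ℝ) + 1) * ((2 * (c : ℝ) + 8) * ((Nat.log 2 m : ℝ) + 1)) ≤ P * β := by nlinarith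
    calc ((Nat.log 2 d : ℝ) + 1) * d + ((Nat.log 2 m : ℝ) + 1) * ((2 * (c : ℝ) + 8) * ((Nat.log 2 m : ℝ) + 1))
        ≤ P * β + P * β := add_le_add h1 h2
      _ = 16 * ((c : ℝ) + 4) * Real.logb 2 m ^ 2 * β := by rw [hP]; ring
  obtain ⟨hm1, hq0, hq1, hhalf, hε, h2t, -, hpos, hB, hmΛ, -, -, -⟩ := hm _ hT
  refine sgAt_tutte_of_cover_budget m _ (kOf m) d _ _ (qOf m) (epsOf c m) hq0 hq1 hhalf hε h2t hpos ?_
  have hV := card_smallSets_le_two_pow m ((2 * c + 8) * (Nat.log 2 m + 1))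
  have hVR : (#(smallSets (Fin m) ((2 * c + 8) * (Nat.log 2 m + 1))) : ℝ) ≤
      (2 : ℝ) ^ ((Nat.log 2 m + 1) * ((2 * c + 8) * (Nat.log 2 m + 1))) := by exact_mod_cast hV
  have hdpow : ((d : ℝ) + 1) ^ d ≤ (2 : ℝ) ^ ((Nat.log 2 d + 1) * d) := by
    have h : (d + 1) ^ d ≤ 2 ^ ((Nat.log 2 d + 1) * d) := by
      rw [pow_mul]
      exact Nat.pow_le_pow_left (Nat.lt_pow_succ_log_self one_lt_two d) d
    exact_mod_cast h
  refine cover_budget_two_pow (Λ := Nat.log 2 m + 1) hm1 (by positivity) hdpow hVR ?_ hmΛ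
  omega

/-- Perfect-matching gates are monotone: the live graph grows with the input vector (`exists_isPerfectMatching_of_le`).
[folklore] -/
theorem monotone_of_tutte {d' : ℕ} (g : GateFn) (P₀ : Set (Fin d' × Fin d')) (P : Fin g.1 → Set (Fin d' × Fin d'))
    (hg : ∀ v : Fin g.1 → Bool, g.2 v = true ↔
      ∃ M : (SimpleGraph.fromRel fun a b : Fin d' =>
        (a, b) ∈ {x : Fin d' × Fin d' | x ∈ P₀ ∨ ∃ i, v i = true ∧ x ∈ P i}).Subgraph, M.IsPerfectMatching) :
    Monotone g.2 := by
  intro v w hvw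
  cases hv : g.2 v
  · exact Bool.false_le _
  · have hle : (SimpleGraph.fromRel fun a b : Fin d' =>
          (a, b) ∈ {x : Fin d' × Fin d' | x ∈ P₀ ∨ ∃ i, v i = true ∧ x ∈ P i}) ≤
        SimpleGraph.fromRel fun a b : Fin d' =>
          (a, b) ∈ {x : Fin d' × Fin d' | x ∈ P₀ ∨ ∃ i, w i = true ∧ x ∈ P i} := by
      intro a b hab
      rw [fromRel_adj] at hab ⊢
      refine ⟨hab.1, hab.2.imp ?_ ?_⟩ <;>
      · rintro (h | ⟨i, hi, h⟩)
        · exact Or.inl h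
        · exact Or.inr ⟨i, eq_true_of_le_of_eq_true (hvw i) hi, h⟩
    rw [(hg w).2 (exists_isPerfectMatching_of_le hle ((hg v).1 hv))]

open Classical in
/-- **Collapse `TUTTE_d ∘ OR ⊆ TUTTE_d`.** A perfect-matching gate fed with small-clique DNFs `⌈A_i⌉`, `A_i ⊆ 𝒱(l)`, is a
perfect-matching term gate over the atoms `X ∈ ⋃ A_i`: rewire the patterns, `P'_{(i,X)} := P_i` (same `d'`, `P₀`); the
live cell set, hence the live graph, is unchanged (`acceptsB_eq_true_iff_exists_atom`). [folklore] -/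
theorem isTermGate_tutte_collapse (m l d : ℕ) (g : GateFn) (A : Fin g.1 → Finset (Finset (Fin m)))
    (hA : ∀ i, A i ⊆ smallSets (Fin m) l)
    (hg : ∃ d' : ℕ, d' ≤ d ∧ ∃ (P₀ : Set (Fin d' × Fin d')) (P : Fin g.1 → Set (Fin d' × Fin d')),
      ∀ v : Fin g.1 → Bool, g.2 v = true ↔
        ∃ M : (SimpleGraph.fromRel fun a b : Fin d' =>
          (a, b) ∈ {x : Fin d' × Fin d' | x ∈ P₀ ∨ ∃ i, v i = true ∧ x ∈ P i}).Subgraph, M.IsPerfectMatching) :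
    IsTermGate m (fun g' => ∃ d' : ℕ, d' ≤ d ∧ ∃ (P₀ : Set (Fin d' × Fin d')) (P : Fin g'.1 → Set (Fin d' × Fin d')),
      ∀ v : Fin g'.1 → Bool, g'.2 v = true ↔
        ∃ M : (SimpleGraph.fromRel fun a b : Fin d' =>
          (a, b) ∈ {x : Fin d' × Fin d' | x ∈ P₀ ∨ ∃ i, v i = true ∧ x ∈ P i}).Subgraph, M.IsPerfectMatching) l
      (fun x => g.2 fun i => acceptsB (A i) x) := by
  obtain ⟨d', hd', P₀, P, hgP⟩ := hg
  set e := Fintype.equivFin (Σ i : Fin g.1, {X // X ∈ A i}) with he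
  set N := Fintype.card (Σ i : Fin g.1, {X // X ∈ A i}) with hN
  set π : Fin N → Fin g.1 := fun a => (e.symm a).1 with hπ
  -- the rewired gate: accept iff the rewired live graph has a perfect matching
  set R : (Fin N → Bool) → Prop := fun w => ∃ M : (SimpleGraph.fromRel fun a b : Fin d' =>
    (a, b) ∈ {x : Fin d' × Fin d' | x ∈ P₀ ∨ ∃ a', w a' = true ∧ x ∈ P (π a')}).Subgraph, M.IsPerfectMatching with hR
  refine ⟨⟨N, fun w => decide (R w)⟩, ⟨d', hd', P₀, fun a => P (π a), fun w => ?_⟩,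
    fun a => ((e.symm a).2 : Finset (Fin m)), fun a => hA _ (e.symm a).2.2, fun x => ?_⟩
  · change decide (R w) = true ↔ R w
    rw [decide_eq_true_iff]
  · -- the live cell sets agree
    have hpat : {y : Fin d' × Fin d' | y ∈ P₀ ∨ ∃ i, (fun i => acceptsB (A i) x) i = true ∧ y ∈ P i} =
        {y : Fin d' × Fin d' | y ∈ P₀ ∨ ∃ a, (fun a => atomB ((e.symm a).2 : Finset (Fin m)) x) a = true ∧
          y ∈ P (π a)} := by
      ext y
      simp only [Set.mem_setOf_eq]
      refine or_congr_right ?_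
      constructor
      · rintro ⟨i, hi, hy⟩
        obtain ⟨a, ha, hat⟩ := (acceptsB_eq_true_iff_exists_atom A e x i).1 hi
        exact ⟨a, hat, by rw [hπ]; dsimp only; rw [ha]; exact hy⟩
      · rintro ⟨a, ha, hy⟩
        exact ⟨π a, (acceptsB_eq_true_iff_exists_atom A e x (π a)).2 ⟨a, rfl, ha⟩, hy⟩
    have hRx : R (fun a => atomB ((e.symm a).2 : Finset (Fin m)) x) ↔
        ∃ M : (SimpleGraph.fromRel fun a b : Fin d' =>
          (a, b) ∈ {y : Fin d' × Fin d' | y ∈ P₀ ∨ ∃ i, (fun i => acceptsB (A i) x) i = true ∧ y ∈ P i}).Subgraph,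
          M.IsPerfectMatching := by
      rw [hpat]
    change g.2 (fun i => acceptsB (A i) x) = decide (R fun a => atomB ((e.symm a).2 : Finset (Fin m)) x)
    cases hv : g.2 (fun i => acceptsB (A i) x)
    · symm
      rw [decide_eq_false_iff_not]
      intro hRt
      simpa [hv] using (hgP _).2 (hRx.1 hRt)
    · symm
      rw [decide_eq_true_iff]
      exact hRx.2 ((hgP _).1 hv)

/-- **No polynomial-size monotone circuit with perfect-matching gates on `≤ m^{7/8-o(1)}` vertices computes
`CLIQUE(m, ⌈m^{1/8}⌉)` (unconditional).** For every `c`, eventually in `m`, for every `d` with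
`d · log₂ d ≤ m^{7/8}/(log₂ m)^5` and every circuit `C` with `≤ m^c` gates over `{∧₂, ∨₂} ∪ TUTTE_d` — gates accepting iff
the graph on `[d']`, `d' ≤ d`, spanned by the cells `P₀ ∪ ⋃_{v_i = 1} P_i` has a PERFECT MATCHING (Tutte's 1-factor function
of general graphs as a wide gate; unbounded fan-in, arbitrary pattern-valued inputs; matching-number thresholds via universal
vertices in `P₀`): `¬ C.Computes CLIQUE(m, ⌈m^{1/8}⌉)`. The level-`l` door theorem at `l = L(c,m)` with `monotone_of_tutte`,
`isTermGate_tutte_collapse` and `sgAt_tutte_logWidth`. [folklore] -/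
theorem not_computes_clique_of_isOver_tutte_logWidth : ∀ c : ℕ, ∀ᶠ m : ℕ in atTop, ∀ d : ℕ,
    (d : ℝ) * Real.logb 2 d ≤ (m : ℝ) ^ (7 / 8 : ℝ) / Real.logb 2 m ^ 5 →
    ∀ C : Circuit (KEdge m), C.IsOver ({GateFn.and 2, GateFn.or 2} ∪
      {g : GateFn | ∃ d' : ℕ, d' ≤ d ∧ ∃ (P₀ : Set (Fin d' × Fin d')) (P : Fin g.1 → Set (Fin d' × Fin d')),
        ∀ v : Fin g.1 → Bool, g.2 v = true ↔
          ∃ M : (SimpleGraph.fromRel fun a b : Fin d' =>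
            (a, b) ∈ {x : Fin d' × Fin d' | x ∈ P₀ ∨ ∃ i, v i = true ∧ x ∈ P i}).Subgraph, M.IsPerfectMatching}) →
      C.size ≤ m ^ c → ¬ C.Computes (cliqueFn m ⌈(m : ℝ) ^ (1 / 8 : ℝ)⌉₊) := by
  intro c
  filter_upwards [not_computes_clique_of_collapse_level c, sgAt_tutte_logWidth c, logWidth_le_lOf c]
    with m hhost hSG hLl d hd C hC hsize
  refine hhost ((2 * c + 8) * (Nat.log 2 m + 1)) (Nat.le_mul_of_pos_right _ (Nat.succ_pos _)) hLl _ _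
    (fun g hg => ?_) (fun g hg A hA => isTermGate_tutte_collapse m _ d g A hA hg) (hSG d hd) C hC hsize
  obtain ⟨d', -, P₀, P, hgP⟩ := hg
  exact monotone_of_tutte g P₀ P hgP

end Summit.PneNP.PneNP.Theorems

end
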